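import Summits.SmoothPoincare4.SmoothPoincare4.Theorems.RootDecompAEDoublesShadowLEOnePeelBlocks
import Summits.SmoothPoincare4.SmoothPoincare4.Theorems.RootDecompAEDoublesShadowLEOnePeelLocalTable
import Summits.SmoothPoincare4.SmoothPoincare4.Theorems.RootDecompAEDoublesShadowLEOnePeelTable

/-!
# Peeling theorem for KMN encoding graphs, part 5/8: the geometry of a gluing at a piece; the local step

§7 (second part) For a gluing `e` touching a piece `u`: the other end, the port and port word of `u` it uses, the
sign and inversion with which the `u`-letters enter its relator, the table entries at `u` (`tab_u`, `tab_far`) and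
the evaluation of a substitution killing everything but the `u`-letters (`lift_rel_u`).  THE LOCAL STEP
`local_step`: if the rows at `u` form a unimodular block on the used letters of `u`, the local table (★) yields
local certificate data `LocalData`.

THE FAMILY (eight modules `Theorems/RootDecompAEDoublesShadowLEOnePeel*.lean` + the closing module
`Theorems/RootDecompAEDoublesShadowLEOneStubPeelCertificates.lean`, one namespace
`Summit.SmoothPoincare4.SmoothPoincare4.Theorems.RootDecompAEDoublesShadowLEOneStubPeelCertificates`, split by topic to respect the
400-line bound on proof files): `…PeelDefs` (verbatim twins of the skeleton's `Piece`, `ShadowGraph`,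
`PeelCertificates`; free-group exponent sums; `H₁ = 0 ⟹` unimodular exponent matrix) · `…PeelBlocks` (unimodular
finset-indexed blocks of an integer table: splitting and rank bounds; the tree of pieces and its leaves) ·
`…PeelLocalTable` (the local table (★) of the twelve pieces) · `…PeelTable` (exponent sums of the relators of `P(G)`;
rows and used letters of a peeling state) · `…PeelLocalStep` (the geometry of a gluing at a piece; local certificate
data from local unimodularity) · `…PeelCombine` (certificates of peeling states; the combination step; the set
algebra of one peeling step) · `…PeelRecursion` (the peeling recursion; the unimodular start) ·
`…StubPeelCertificates` (step L0 and the extraction: `theorem stub_peelCertificates : PeelCertificates`).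
-/

open Function
open Literature.Topology.FourManifolds

set_option linter.dupNamespace false

noncomputable section

namespace Summit.SmoothPoincare4.SmoothPoincare4.Theorems.RootDecompAEDoublesShadowLEOneStubPeelCertificates

namespace ShadowGraph

variable (G : ShadowGraph)

/-! ### The geometry of a gluing `e` at one of its end pieces `u` -/

/-- The other end piece. -/
def other (e : Fin G.m) (u : Fin G.k) : Fin G.k := if (G.src e).1 = u then (G.tgt e).1 else (G.src e).1

/-- The port of `u` used by `e`. -/
def uport (e : Fin G.m) (u : Fin G.k) : ℕ := if (G.src e).1 = u then (G.src e).2 else (G.tgt e).2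

/-- The port word of `u` used by `e`. -/
def uword (e : Fin G.m) (u : Fin G.k) : FreeGroup (Fin 2) := (G.piece u).portWord (G.uport e u)

/-- The sign with which the `u`-letters enter the exponent table in row `e`. -/
def ucoef (e : Fin G.m) (u : Fin G.k) : ℤ := if (G.src e).1 = u then 1 else G.osgn e

/-- Whether the `u`-side port word enters the relator inverted. -/
def uflip (e : Fin G.m) (u : Fin G.k) : Bool := !decide ((G.src e).1 = u) && !G.sgn e

/-- The port reference of the `u`-end of `e`. -/
def uref (e : Fin G.m) (u : Fin G.k) : Fin G.m ⊕ Fin G.m := if (G.src e).1 = u then Sum.inl e else Sum.inr e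

variable {G}

/-- The port reference of the `u`-end of `e` points at the port `uport e u` of `u`. -/
theorem endpoints_uref {e : Fin G.m} {u : Fin G.k} (ht : (G.src e).1 = u ∨ (G.tgt e).1 = u) :
    G.endpoints (G.uref e u) = (u, G.uport e u) := by
  unfold uref uport endpoints
  by_cases hs : (G.src e).1 = u
  · simp only [hs, if_true, Sum.elim_inl]
    exact Prod.ext hs rfl
  · have ht' : (G.tgt e).1 = u := ht.resolve_left hs
    simp only [hs, if_false, Sum.elim_inr]
    exact Prod.ext ht' rfl

/-- A gluing between different pieces has its other end away from `u`. -/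
theorem other_ne {e : Fin G.m} {u : Fin G.k} (hself : (G.src e).1 ≠ (G.tgt e).1) : G.other e u ≠ u := by
  unfold other
  by_cases hs : (G.src e).1 = u
  · rw [if_pos hs]; rw [hs] at hself; exact fun h => hself h.symm
  · rw [if_neg hs]; exact hs

/-- The two ways a gluing can touch `u`: as its source or as its target. -/
theorem ends_eq {e : Fin G.m} {u : Fin G.k} (ht : (G.src e).1 = u ∨ (G.tgt e).1 = u) :
    ((G.src e).1 = u ∧ (G.tgt e).1 = G.other e u) ∨ ((G.tgt e).1 = u ∧ (G.src e).1 = G.other e u) := by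
  unfold other
  by_cases hs : (G.src e).1 = u
  · exact Or.inl ⟨hs, by rw [if_pos hs]⟩
  · exact Or.inr ⟨ht.resolve_left hs, by rw [if_neg hs]⟩

/-- A piece different from both ends of `e` sees nothing of row `e`. -/
theorem ne_ends_of_ne {e : Fin G.m} {u v : Fin G.k} (ht : (G.src e).1 = u ∨ (G.tgt e).1 = u) (hvu : v ≠ u)
    (hvo : v ≠ G.other e u) : (G.src e).1 ≠ v ∧ (G.tgt e).1 ≠ v := by
  rcases ends_eq ht with ⟨h1, h2⟩ | ⟨h1, h2⟩
  · exact ⟨fun h => hvu (h.symm.trans h1), fun h => hvo (h.symm.trans h2)⟩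
  · exact ⟨fun h => hvo (h.symm.trans h2), fun h => hvu (h.symm.trans h1)⟩

/-- The unordered pair of end pieces of a gluing touching `u`. -/
theorem epair_eq {e : Fin G.m} {u : Fin G.k} (ht : (G.src e).1 = u ∨ (G.tgt e).1 = u) :
    G.epair e = s(u, G.other e u) := by
  unfold epair
  rcases ends_eq ht with ⟨h1, h2⟩ | ⟨h1, h2⟩
  · rw [h1, ← h2]
  · rw [h1, ← h2, Sym2.eq_swap]

/-- A (tree) gluing touching `u` makes `u` adjacent to its other end. -/
theorem adj_other {e : Fin G.m} {u : Fin G.k} (hall : ∀ e, G.tree e = true) (hself : (G.src e).1 ≠ (G.tgt e).1)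
    (ht : (G.src e).1 = u ∨ (G.tgt e).1 = u) : G.treeAdj.Adj u (G.other e u) :=
  (G.treeAdj_iff _ _).mpr ⟨(other_ne hself).symm, e, hall e, epair_eq ht⟩

/-- A gluing with end pair `{u, w}` touches both `u` and `w`. -/
theorem touches_of_epair {e : Fin G.m} {u w : Fin G.k} (h : G.epair e = s(u, w)) :
    ((G.src e).1 = u ∨ (G.tgt e).1 = u) ∧ ((G.src e).1 = w ∨ (G.tgt e).1 = w) := by
  unfold epair at h
  rw [Sym2.eq_iff] at h
  rcases h with ⟨h1, h2⟩ | ⟨h1, h2⟩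
  · exact ⟨Or.inl h1, Or.inr h2⟩
  · exact ⟨Or.inr h2, Or.inl h1⟩

/-- A gluing with end pair `{u, w}` has other end `w` at `u`. -/
theorem other_eq_of_epair {e : Fin G.m} {u w : Fin G.k} (hself : (G.src e).1 ≠ (G.tgt e).1)
    (h : G.epair e = s(u, w)) : G.other e u = w := by
  have ht := (touches_of_epair h).1
  have h' := epair_eq ht
  rw [h, Sym2.eq_iff] at h'
  rcases h' with ⟨-, h2⟩ | ⟨h1, -⟩
  · exact h2.symm
  · exact absurd h1.symm (other_ne hself)

/-- The port of `u` used by a gluing exists. -/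
theorem uport_lt (hV : G.PortsValid) {e : Fin G.m} {u : Fin G.k} (ht : (G.src e).1 = u ∨ (G.tgt e).1 = u) :
    G.uport e u < (G.piece u).numPorts := by
  unfold uport
  obtain ⟨h1, h2⟩ := hV e
  by_cases hs : (G.src e).1 = u
  · rw [if_pos hs, ← hs]; exact h1
  · rw [if_neg hs, ← ht.resolve_left hs]; exact h2

/-- Two different gluings at `u` use different ports of `u` (no port is glued twice). -/
theorem uport_ne (hI : G.PortsInjective) {e₁ e₂ : Fin G.m} {u : Fin G.k} (hne : e₁ ≠ e₂)
    (ht₁ : (G.src e₁).1 = u ∨ (G.tgt e₁).1 = u) (ht₂ : (G.src e₂).1 = u ∨ (G.tgt e₂).1 = u) :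
    G.uport e₁ u ≠ G.uport e₂ u := by
  intro h
  have h12 : G.endpoints (G.uref e₁ u) = G.endpoints (G.uref e₂ u) := by
    rw [endpoints_uref ht₁, endpoints_uref ht₂, h]
  have := hI h12
  unfold uref at this
  split_ifs at this <;> simp_all

/-- THE TABLE AT `u`: the entry of a `u`-letter in the row of a gluing at `u` is the signed exponent sum of the letter in the used port word. -/
theorem tab_u {e : Fin G.m} {u : Fin G.k} (hself : (G.src e).1 ≠ (G.tgt e).1)
    (ht : (G.src e).1 = u ∨ (G.tgt e).1 = u) (i : Fin 2) :
    G.tab e (Sum.inl (u, i)) = G.ucoef e u * expo i (G.uword e u) := by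
  unfold tab ucoef uword uport
  rw [expo_inl_gluingRelator, expo_inl_portWordAt, expo_inl_portWordAt]
  by_cases hs : (G.src e).1 = u
  · have ht' : (G.tgt e).1 ≠ u := fun h => hself (hs.trans h.symm)
    simp only [hs, if_true, ht', if_false, mul_zero, add_zero, one_mul]
  · have ht' : (G.tgt e).1 = u := ht.resolve_left hs
    simp only [hs, if_false, ht', if_true, zero_add]

/-- A piece not touched by the gluing `e` contributes nothing to row `e`. -/
theorem tab_far {e : Fin G.m} {v : Fin G.k} (h1 : (G.src e).1 ≠ v) (h2 : (G.tgt e).1 ≠ v) (i : Fin 2) :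
    G.tab e (Sum.inl (v, i)) = 0 := by
  unfold tab
  rw [expo_inl_gluingRelator, expo_inl_portWordAt, expo_inl_portWordAt, if_neg h1, if_neg h2]
  simp

/-- The sign with which the `u`-letters enter row `e` is a unit. -/
theorem isUnit_ucoef (e : Fin G.m) (u : Fin G.k) : IsUnit (G.ucoef e u) := by
  unfold ucoef; split_ifs; · simp
  · exact G.isUnit_osgn e

/-- EVALUATION of a substitution on the relator of a gluing `e` at `u` that kills the stable letter and all letters
of the other end piece: what remains is the (possibly inverted) image of the `u`-side port word. -/
theorem lift_rel_u {e : Fin G.m} {u : Fin G.k} (ht : (G.src e).1 = u ∨ (G.tgt e).1 = u)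
    (hself : (G.src e).1 ≠ (G.tgt e).1) (F : G.Gen → FreeGroup G.Gen) (hFe : F (Sum.inr e) = 1)
    (hFw : ∀ i, F (Sum.inl (G.other e u, i)) = 1) :
    FreeGroup.lift F (G.gluingRelator e) = sgnw (G.uflip e u) (FreeGroup.lift (F ∘ G.ltr u) (G.uword e u)) := by
  rw [lift_gluingRelator, hFe]
  unfold uflip uword uport
  rcases ends_eq ht with ⟨h1, h2⟩ | ⟨h1, h2⟩
  · have hw : F ∘ G.ltr (G.tgt e).1 = fun _ => 1 := funext fun i => by rw [h2]; exact hFw i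
    rw [hw, lift_const_one]
    simp only [h1, decide_true, Bool.not_true, Bool.false_and, if_true]
    rw [← h1]
    cases G.sgn e <;> simp [sgnw]
  · have hw : F ∘ G.ltr (G.src e).1 = fun _ => 1 := funext fun i => by rw [h2]; exact hFw i
    have hs : (G.src e).1 ≠ u := fun h => hself (h.trans h1.symm)
    rw [hw, lift_const_one]
    simp only [hs, decide_false, Bool.not_false, Bool.true_and]
    rw [← h1]
    cases G.sgn e <;> simp [sgnw]

variable (G)

/-! ### Local certificates at a piece and their extraction from local unimodularity -/

/-- LOCAL CERTIFICATE DATA at the piece `u` for its assigned rows `ru`: owner letters `lamU`, signs `tU`, local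
ranks `lr` (unused letters ranked lowest), with the local validity equations. -/
def LocalData (u : Fin G.k) (ru : Finset (Fin G.m)) (lamU : Fin G.m → Fin 2) (tU : Fin G.m → Bool)
    (lr : Fin 2 → ℕ) : Prop :=
  (∀ e₁ ∈ ru, ∀ e₂ ∈ ru, lamU e₁ = lamU e₂ → e₁ = e₂) ∧ (∀ j, lr j < 2) ∧
    (∀ e ∈ ru, ((lamU e : Fin 2) : ℕ) < (G.piece u).rank) ∧
    (∀ j : Fin 2, (G.piece u).rank ≤ (j : ℕ) → ∀ e ∈ ru, lr j < lr (lamU e)) ∧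
    ∀ e ∈ ru, FreeGroup.lift (fun j : Fin 2 => if lr j < lr (lamU e) then (1 : FreeGroup (Fin 2)) else FreeGroup.of j)
      (sgnw (tU e) (G.uword e u)) = FreeGroup.of (lamU e)

variable {G}

/-- THE LOCAL STEP: if the rows `ru` at `u` (as many as the rank of the piece) form a unimodular block on the
used letters of `u`, the local table (★) provides local certificate data. -/
theorem local_step (hV : G.PortsValid) (hI : G.PortsInjective) (hself : ∀ e, (G.src e).1 ≠ (G.tgt e).1)
    (u : Fin G.k) (ru : Finset (Fin G.m)) (hru : ∀ e ∈ ru, (G.src e).1 = u ∨ (G.tgt e).1 = u)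
    (hcard : ru.card = (G.piece u).rank) (hU : UM G.tab ru (G.cols {u})) :
    ∃ lamU tU lr, G.LocalData u ru lamU tU lr := by
  classical
  have h2 := rank_le_two (G.piece u)
  rcases Nat.lt_or_ge (G.piece u).rank 1 with hr0 | hr1
  · -- rank 0: no rows
    have hr : (G.piece u).rank = 0 := by omega
    rw [hr, Finset.card_eq_zero] at hcard
    subst hcard
    refine ⟨fun _ => 0, fun _ => false, fun _ => 0, ?_, fun j => by simp, ?_, ?_, ?_⟩ <;> simp
  rcases Nat.lt_or_ge (G.piece u).rank 2 with hr1' | hr2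
  · -- rank 1: one row, its port word has unit exponent, hence is the letter `a`
    have hr : (G.piece u).rank = 1 := by omega
    rw [hr, Finset.card_eq_one] at hcard
    obtain ⟨e, rfl⟩ := hcard
    have hte := hru e (Finset.mem_singleton_self e)
    rw [G.cols_singleton_of_rank_one u hr] at hU
    have h1 := hU.isUnit_entry
    rw [tab_u (hself e) hte] at h1
    have hexp : IsUnit (expo 0 (G.uword e u)) := (IsUnit.mul_iff.mp h1).2
    have hw : G.uword e u = FreeGroup.of 0 :=
      localTable_rank_one (G.piece u) hr (G.uport e u) (uport_lt hV hte) hexp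
    refine ⟨fun _ => 0, fun _ => false, fun j => if j = 0 then 1 else 0, ?_, ?_, ?_, ?_, ?_⟩
    · intro e₁ h₁ e₂ h₂ _
      rw [Finset.mem_singleton] at h₁ h₂
      rw [h₁, h₂]
    · intro j; dsimp only; split_ifs <;> omega
    · intro e' _; rw [hr]; simp
    · intro j hj e' _
      rw [hr] at hj
      have : j = 1 := Fin.ext (by have := j.is_lt; omega)
      subst this
      simp
    · intro e' he'
      rw [Finset.mem_singleton] at he'
      subst he'
      rw [hw]
      simp [sgnw]
  · -- rank 2: two rows, unimodular 2 × 2 exponent block, local table (★)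
    have hr : (G.piece u).rank = 2 := by omega
    rw [hr, Finset.card_eq_two] at hcard
    obtain ⟨e₁, e₂, hne, rfl⟩ := hcard
    have ht₁ := hru e₁ (by simp)
    have ht₂ := hru e₂ (by simp)
    rw [G.cols_singleton_of_rank_two u hr] at hU
    have hdet := hU.isUnit_det2 hne (by simp)
    rw [tab_u (hself e₁) ht₁, tab_u (hself e₁) ht₁, tab_u (hself e₂) ht₂, tab_u (hself e₂) ht₂] at hdet
    have hdet' : IsUnit (expo 0 (G.uword e₁ u) * expo 1 (G.uword e₂ u) - expo 1 (G.uword e₁ u) * expo 0 (G.uword e₂ u)) := by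
      have hc := (isUnit_ucoef e₁ u).mul (isUnit_ucoef e₂ u)
      have e : G.ucoef e₁ u * expo 0 (G.uword e₁ u) * (G.ucoef e₂ u * expo 1 (G.uword e₂ u)) -
          G.ucoef e₁ u * expo 1 (G.uword e₁ u) * (G.ucoef e₂ u * expo 0 (G.uword e₂ u)) =
          (G.ucoef e₁ u * G.ucoef e₂ u) *
            (expo 0 (G.uword e₁ u) * expo 1 (G.uword e₂ u) - expo 1 (G.uword e₁ u) * expo 0 (G.uword e₂ u)) := by
        ring
      rw [e] at hdet
      exact (IsUnit.mul_iff.mp hdet).2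
    have hloc := localTable_rank_two (G.piece u) hr (G.uport e₁ u) (G.uport e₂ u) (uport_lt hV ht₁) (uport_lt hV ht₂)
      (uport_ne hI hne ht₁ ht₂) hdet'
    obtain ⟨o, t, lr, hone, hlr, hval⟩ := hloc
    refine ⟨fun e => if e = e₁ then o true else o false, fun e => if e = e₁ then t true else t false, lr,
      ?_, hlr, ?_, ?_, ?_⟩
    · intro x hx y hy hxy
      simp only [Finset.mem_insert, Finset.mem_singleton] at hx hy
      rcases hx with rfl | rfl <;> rcases hy with rfl | rfl
      · rfl
      · simp [hne.symm] at hxy; exact absurd hxy hone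
      · simp [hne.symm] at hxy; exact absurd hxy.symm hone
      · rfl
    · intro e _; rw [hr]; exact Fin.is_lt _
    · intro j hj; rw [hr] at hj; exact absurd j.is_lt (not_lt.mpr hj)
    · intro e he
      simp only [Finset.mem_insert, Finset.mem_singleton] at he
      rcases he with rfl | rfl
      · simpa [uword] using hval true
      · simpa [uword, hne.symm] using hval false

end ShadowGraph

end Summit.SmoothPoincare4.SmoothPoincare4.Theorems.RootDecompAEDoublesShadowLEOneStubPeelCertificates
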